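import Summits.CriticalPhenomena.CardyFormulaZ2.Theorems.CardyAnchoredRigiditySubseqCardyRectDuality
import Literature.Probability.RandomMatrixProducts.AndersonModel1DEstimates

/-!
# Strip crossing exponents are uniformly equicontinuous in one long-box value
# (crux `SubseqCardy`, stmt-CriticalPhenomena-5768, line `registered`, lead c6: kernel facts IV,
# part 4c)

Route `CardyAnchoredRigidity` (decl shared with `CardyLocalRigidity`), sub-problem `CardyFormulaZ2`.
The pure real analysis behind the CONTINUITY of the strip crossing exponent `λ(g)` of a joint
sequential limit `g` as a functional of `g` for the product topology. On the boxes
`L_w = ((0,w) × (0,1); arc 0 = left side, arc 2 = right side)` every joint limit obeys the STRIP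
EXPONENT SANDWICH `exp (-λ w) ≤ g (L_w) ≤ 2 exp (λ (1 - w))`, and `λ ≤ M` uniformly on the cluster
set. We prove (`stripSandwich_equicontinuous`): for all `M` and `ε > 0` there are ONE width `w > 1`
and a `δ > 0` such that any two functions `g, g'` on conformal rectangles obeying such sandwiches
with exponents `l, l' ≤ M` and with `|g L - g' L| < δ` at the boxes `L` of width `w` have
`|l - l'| < ε`: the exponent is pinned by the single value `g (L_w)` up to an error `O(1/w)`
uniform in `l ≤ M`, and that value enters through a logarithm, uniformly continuous on the
relevant range `[exp (-M⁺ w), ∞)`.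

Proof. Put `M⁺ = max M 0`, `c = log 2`, choose `w` with `ε (w - 1) = 3 (M⁺ + c + 1)`, put
`m₀ = exp (-M⁺ w)`, `δ = ε w m₀ / 3`, and pick one box `L` of width `w` (`JointLimit.exists_lrBox`).
Taking logarithms in the sandwich, `A = -log (g L)` satisfies `A ≤ l w` and `l w - l ≤ A + c`
(`StripExponent.equicont_log_sandwich`), likewise `A' = -log (g' L)` for `l'`; hence
`(l - l') w ≤ (A - A') + c + M⁺` and symmetrically. Both `g L, g' L` are `≥ m₀`, where `log` is
`1/m₀`-Lipschitz (tree: `RandomMatrixProducts.abs_log_sub_log_le`), so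
`|A - A'| ≤ |g L - g' L| / m₀ < ε w / 3`, while `c + M⁺ < ε (w - 1) / 3` by the choice of `w`; so
`|l - l'| w < ε w`.

References: folklore (the bookkeeping of the real-variable Fekete lemma); cf. G. Grimmett,
*Percolation* (1999) §11.7 for the exponential decay of long crossings it is applied to.
-/

noncomputable section

namespace Summit.CriticalPhenomena.CardyFormulaZ2.Cruxes.SubseqCardy.Birth

open Set Filter Topology
open Literature.Probability.RandomPlanarGeometry (ConformalRectangle)

namespace StripExponent

/-- **Logarithmic form of the strip sandwich at one box.** If `exp (-(l w)) ≤ x ≤ 2 exp (l (1 - w))`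
then `A = -log x` satisfies `A ≤ l w` and `l w - l ≤ A + log 2`. [folklore] -/
theorem equicont_log_sandwich {x l w : ℝ} (h1 : Real.exp (-(l * w)) ≤ x)
    (h2 : x ≤ 2 * Real.exp (l * (1 - w))) :
    -Real.log x ≤ l * w ∧ l * w - l ≤ -Real.log x + Real.log 2 := by
  have hx : 0 < x := (Real.exp_pos _).trans_le h1
  constructor
  · have h := Real.log_le_log (Real.exp_pos _) h1
    rw [Real.log_exp] at h
    linarith
  · have h := Real.log_le_log hx h2
    rw [Real.log_mul two_ne_zero (Real.exp_pos _).ne', Real.log_exp] at h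
    linarith

/-- **A uniform floor for the long-box values.** If `l ≤ M⁺`, `0 ≤ w` and `exp (-(l w)) ≤ x` then
`exp (-(M⁺ w)) ≤ x`. [folklore] -/
theorem equicont_floor {x l Mp w : ℝ} (hl : l ≤ Mp) (hw : 0 ≤ w) (h1 : Real.exp (-(l * w)) ≤ x) :
    Real.exp (-(Mp * w)) ≤ x := by
  refine le_trans (Real.exp_le_exp.2 ?_) h1
  have := mul_le_mul_of_nonneg_right hl hw
  linarith

end StripExponent

/-- **Strip exponents are uniformly equicontinuous in one long-box value** (kernel facts IV,
part 4c). For every bound `M` and every `ε > 0` there are a width `w > 1` and a `δ > 0` such that: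
whenever `g, g'` satisfy the strip exponent sandwiches
`exp (-(l v)) ≤ g (L_v) ≤ 2 exp (l (1 - v))`, `exp (-(l' v)) ≤ g' (L_v) ≤ 2 exp (l' (1 - v))` on all
boxes `L_v = ((0,v) × (0,1); arc 0 = left side, arc 2 = right side)`, `v > 0`, with exponents
`l, l' ≤ M`, and `|g L - g' L| < δ` on the boxes `L` of the one width `w`, then `|l - l'| < ε`.
[folklore] -/
theorem stripSandwich_equicontinuous : ∀ (M ε : ℝ), 0 < ε → ∃ w : ℝ, 1 < w ∧ ∃ δ : ℝ, 0 < δ ∧ ∀ (g g' : Literature.Probability.RandomPlanarGeometry.ConformalRectangle → ℝ) (l l' : ℝ), l ≤ M → l' ≤ M → (∀ w : ℝ, 0 < w → ∀ L : Literature.Probability.RandomPlanarGeometry.ConformalRectangle, L.carrier = (Set.Ioo (0:ℝ) w ×ℂ Set.Ioo (0:ℝ) 1) → L.arc 0 = {z : ℂ | z.re = 0 ∧ z.im ∈ Set.Icc (0:ℝ) 1} → L.arc 2 = {z : ℂ | z.re = w ∧ z.im ∈ Set.Icc (0:ℝ) 1} → Real.exp (-(l * w)) ≤ g L ∧ g L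 ≤ 2 * Real.exp (l * (1 - w))) → (∀ w : ℝ, 0 < w → ∀ L : Literature.Probability.RandomPlanarGeometry.ConformalRectangle, L.carrier = (Set.Ioo (0:ℝ) w ×ℂ Set.Ioo (0:ℝ) 1) → L.arc 0 = {z : ℂ | z.re = 0 ∧ z.im ∈ Set.Icc (0:ℝ) 1} → L.arc 2 = {z : ℂ | z.re = w ∧ z.im ∈ Set.Icc (0:ℝ) 1} → Real.exp (-(l' * w)) ≤ g' L ∧ g' L ≤ 2 * Real.exp (l' * (1 - w))) → (∀ L : Literature.Probability.RandomPlanarGeometry.ConformalRectangle, L.carrier = (Set.Ioo (0:ℝ) w ×ℂ Set.Ioo (0:ℝ) 1) → L.arc 0 = {z : ℂ | z.re = 0 ∧ z.im ∈ Set.Icc (0:ℝ) 1} → L.arc 2 = {z : ℂ | z.re = w ∧ z.im ∈ Set.Icc (0:ℝ) 1} → |g L - g' L| < δ) → |l - l'| < ε := by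
  intro M ε hε
  -- `M⁺ = max M 0`, used only through `M ≤ M⁺` and `0 ≤ M⁺`
  obtain ⟨Mp, hMMp, hMp0⟩ : ∃ Mp : ℝ, M ≤ Mp ∧ 0 ≤ Mp :=
    ⟨max M 0, le_max_left _ _, le_max_right _ _⟩
  have hc0 : 0 < Real.log 2 := Real.log_pos (by norm_num)
  -- the width: `ε (w - 1) = 3 (M⁺ + log 2 + 1)`
  obtain ⟨w, hw1, hKw⟩ : ∃ w : ℝ, 1 < w ∧ ε * w = ε + 3 * (Mp + Real.log 2 + 1) := by
    refine ⟨1 + 3 * (Mp + Real.log 2 + 1) / ε, ?_, ?_⟩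
    · have : 0 < 3 * (Mp + Real.log 2 + 1) / ε := by positivity
      linarith
    · rw [mul_add, mul_one, mul_div_cancel₀ _ hε.ne']
  have hw0 : 0 < w := one_pos.trans hw1
  -- the floor `m₀ = exp (-(M⁺ w))` of the long-box values at width `w`
  obtain ⟨m₀, hm₀, hfloor⟩ : ∃ m₀ : ℝ, 0 < m₀ ∧
      ∀ (l₁ x : ℝ), l₁ ≤ M → Real.exp (-(l₁ * w)) ≤ x → m₀ ≤ x :=
    ⟨Real.exp (-(Mp * w)), Real.exp_pos _, fun l₁ x hl₁ hx =>
      StripExponent.equicont_floor (hl₁.trans hMMp) hw0.le hx⟩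
  refine ⟨w, hw1, ε * w * m₀ / 3, by positivity, ?_⟩
  intro g g' l l' hl hl' hg hg' hclose
  -- one box of width `w`
  obtain ⟨L, hLc, hL0, hL2⟩ := JointLimit.exists_lrBox w hw0
  obtain ⟨h1, h2⟩ := hg w hw0 L hLc hL0 hL2
  obtain ⟨h1', h2'⟩ := hg' w hw0 L hLc hL0 hL2
  have hd : |g L - g' L| < ε * w * m₀ / 3 := hclose L hLc hL0 hL2
  -- logarithmic sandwiches for `l` and `l'`
  obtain ⟨hA1, hA2⟩ := StripExponent.equicont_log_sandwich h1 h2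
  obtain ⟨hA1', hA2'⟩ := StripExponent.equicont_log_sandwich h1' h2'
  -- the logarithms are close: `log` is `1/m₀`-Lipschitz on `[m₀, ∞)`
  have hlog : |Real.log (g L) - Real.log (g' L)| < ε * w / 3 := by
    refine (Literature.Probability.RandomMatrixProducts.abs_log_sub_log_le hm₀ (hfloor l _ hl h1)
      (hfloor l' _ hl' h1')).trans_lt ?_
    rw [div_lt_iff₀ hm₀]
    linarith
  rw [abs_sub_lt_iff] at hlog ⊢
  obtain ⟨hlog1, hlog2⟩ := hlog
  constructor
  · -- `(l - l') w ≤ (A - A') + log 2 + M⁺ < ε w / 3 + ε (w - 1) / 3`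
    have key : (l - l') * w < ε * w := by linarith
    exact lt_of_mul_lt_mul_right key hw0.le
  · have key : (l' - l) * w < ε * w := by linarith
    exact lt_of_mul_lt_mul_right key hw0.le

end Summit.CriticalPhenomena.CardyFormulaZ2.Cruxes.SubseqCardy.Birth
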